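import Mathlib
import Literature.Probability.Percolation.RapidityUnivariate
import Literature.Probability.Percolation.DiagonalStripSumInversion
import HarnessLib

/-!
# The reflected wheel roots `z_1 z_j = q` of the recursion scalar (IP12 (25)–(27))

Topic `Literature/Probability/Percolation`. Ikhlef–Ponsaing (J. Stat. Phys. 149 (2012),
arXiv:1202.5476) eq. (25)/(27): the scalar of the ground-state recursion on `z_2 = q z_1` is
`∏_{j ≥ 3} k(z_1, z_j)`, `k(a,b) = [q b/a][q/(a b)]`, whose zeros in `z_1` are `z_1 = ±q z_j` and
`z_1 = ±q/z_j`. For the exact ground state of this development we obtain the zeros `q z_j` AND the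
reflected zeros `q / z_j` of `Θ₂ Z := rapUni 1 (η_1 (Σ_Q P_Q)) ∈ (RapidityField ℂ)[T]` (the sum on the
hyperplane as a polynomial in `T = z_1`) with no explicit component of `Ψ`:

* `ringHom_monomial`, `hom_revPoly_eq` — reversal of the `X_k`-exponents against a pair of
  homomorphisms `h, h'` with `h'(X_k) h(X_k) = 1`;
* `revPoly_eq_X_pow_mul` — polynomial reciprocity from `ι_k (toRF G) = z_k^c toRF G`;
* `rapUni_hypSubst_X`, `eval_rapUni_hypSubst`, `eval_rapUni_hypSubst_genC_mul` — the map `Θ₂` and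
  its root at `q z_j` from `DiagonalStripSumInversion`;
* `map_genInv_rapUni_hypSubst` — `(Θ₂ G).map ι_j = C(z_j^e) · Θ₂ G` (reciprocity in `z_j`, `j ≥ 3`);
* `eval_rapUni_hypSubst_genC_div` — hence a root at `q z_j` reflects to a root at `q / z_j`
  (apply `ι_j` to the evaluation);
* **`sum_wheel_roots`** — for the exact ground state (`ι_1 ψ = z_1^{2a'} ψ`, sum symmetric under all
  transpositions), `Θ₂ Z` vanishes at `q z_j` and at `q / z_j` for every `3 ≤ j ≤ L`.

## References

* Y. Ikhlef, A. K. Ponsaing, *Finite-size left-passage probability in percolation*, J. Stat. Phys.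
  149 (2012) 10–36, arXiv:1202.5476, §3.4 (25), §3.6 (27), proof of Prop. 3.4. [IkhlefPonsaing2012]
-/

namespace Literature.Probability.Percolation

open Finset Literature.Probability.LatticeModels Literature.Probability.LatticeModels.TemperleyLieb

/-! ### Reversal against a pair of homomorphisms -/

section HomReversal

open MvPolynomial

variable {K₀ : Type*} [Field K₀] {S : Type*} [CommRing S]

/-- A ring homomorphism on a monomial. [folklore] -/
theorem ringHom_monomial (φ : MvPolynomial ℕ K₀ →+* S) (t : ℕ →₀ ℕ) (a : K₀) :
    φ (monomial t a) = φ (C a) * t.prod fun i n => φ (X i) ^ n := by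
  have hφ : φ = eval₂Hom (φ.comp C) (fun i => φ (X i)) :=
    ringHom_ext (fun a => by rw [eval₂Hom_C, RingHom.comp_apply]) (fun i => by rw [eval₂Hom_X'])
  conv_lhs => rw [hφ]
  rw [eval₂Hom_monomial, RingHom.comp_apply]

/-- **Reversal against a pair of homomorphisms**: if `h, h'` agree on the constants and on the
`X_i`, `i ≠ k`, and `h'(X_k) · h(X_k) = 1`, then `h (revPoly k N G) = h(X_k)^N · h' G` whenever
`deg_{X_k} G ≤ N`. [folklore] -/
theorem hom_revPoly_eq (h h' : MvPolynomial ℕ K₀ →+* S) (k N : ℕ) (hC : ∀ a, h (C a) = h' (C a))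
    (hX : ∀ i, i ≠ k → h (X i) = h' (X i)) (hk : h' (X k) * h (X k) = 1) (G : MvPolynomial ℕ K₀)
    (hN : G.degreeOf k ≤ N) : h (revPoly k N G) = h (X k) ^ N * h' G := by
  classical
  conv_rhs => rw [G.as_sum, map_sum, Finset.mul_sum]
  rw [revPoly, map_sum]
  refine Finset.sum_congr rfl fun e he => ?_
  have hek : e k ≤ N := (monomial_le_degreeOf k he).trans hN
  rw [ringHom_monomial h, ringHom_monomial h', hC, mul_left_comm]
  congr 1
  have hs : e.support ⊆ insert k e.support := Finset.subset_insert _ _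
  rw [Finsupp.prod_of_support_subset e hs _ (fun i _ => pow_zero _),
    Finsupp.prod_of_support_subset _ (support_revExp_subset k N e) _ (fun i _ => pow_zero _),
    ← Finset.mul_prod_erase _ _ (Finset.mem_insert_self k e.support),
    ← Finset.mul_prod_erase _ _ (Finset.mem_insert_self k e.support), revExp_apply_self, ← mul_assoc]
  congr 1
  · have e1 : h (X k) ^ N = h (X k) ^ (N - e k) * h (X k) ^ (e k) := by rw [← pow_add, Nat.sub_add_cancel hek]
    rw [e1, mul_assoc, ← mul_pow, mul_comm (h (X k)) (h' (X k)), hk, one_pow, mul_one]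
  · refine Finset.prod_congr rfl fun i hi => ?_
    have hik : i ≠ k := (Finset.mem_erase.1 hi).1
    rw [revExp_apply_of_ne _ hik, hX i hik]

/-- **Polynomial reciprocity from reciprocity in the rapidity field**: if `ι_k (toRF G) = z_k^c · toRF G`
then `revPoly k N G = X_k^d · G` for `N = deg_k G + |c|` and `d = N + c ≥ 0`. [folklore] -/
theorem revPoly_eq_X_pow_mul {G : MvPolynomial ℕ K₀} {k : ℕ} {c : ℤ}
    (hrec : genInv K₀ k (toRF K₀ G) = genZ K₀ k ^ c * toRF K₀ G) :
    revPoly k (G.degreeOf k + c.natAbs) G = X k ^ (G.degreeOf k + c.natAbs + c).toNat * G := by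
  have hz : genZ K₀ k ≠ 0 := genZ_ne_zero k
  have hc : -c ≤ (c.natAbs : ℤ) := by have := Int.le_natAbs (a := -c); simpa using this
  have hnn : 0 ≤ ((G.degreeOf k : ℤ) + (c.natAbs : ℤ) + c) := by omega
  apply toRF_injective
  rw [← invSubst_mul_pow_eq k (G.degreeOf k + c.natAbs) G (by omega), ← genInv_toRF, hrec, map_mul, map_pow,
    show toRF K₀ (X k) = genZ K₀ k from rfl]
  rw [mul_assoc, mul_comm (toRF K₀ G), ← mul_assoc, ← zpow_natCast, ← zpow_add₀ hz, ← zpow_natCast]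
  congr 2
  rw [Nat.cast_add, Int.toNat_of_nonneg hnn]
  push_cast
  ring

end HomReversal

/-! ### The reflected wheel roots `z_1 z_j = q` of `η_1(Z)` -/

section ReflectedRoots

open MvPolynomial Polynomial

variable {n : ℕ}

/-- The two-variables-on-a-line map `Θ₂ = rapUni 1 ∘ η_1` on generators. [folklore] -/
theorem rapUni_hypSubst_X (q : ℂ) (k : ℕ) :
    rapUni ℂ 1 (hypSubst q 1 (MvPolynomial.X k)) =
      if k = 1 then Polynomial.X else if k = 2 then Polynomial.C (genC ℂ q) * Polynomial.X
        else Polynomial.C (genZ ℂ k) := by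
  by_cases hk1 : k = 1
  · subst hk1; rw [hypSubst_X_of_ne q (by omega), rapUni_X_self, if_pos rfl]
  rw [if_neg hk1]
  by_cases hk2 : k = 2
  · subst hk2
    rw [if_pos rfl, show (2 : ℕ) = 1 + 1 from rfl, hypSubst_X_self, map_mul, rapUni_C, rapUni_X_self]
  · rw [if_neg hk2, hypSubst_X_of_ne q (show k ≠ 1 + 1 by omega), rapUni_X_of_ne hk1]

/-- **Evaluating `Θ₂ F` at `x`** is the substitution `X_1 ↦ x, X_2 ↦ q x`. [folklore] -/
theorem eval_rapUni_hypSubst (q : ℂ) (x : RapidityField ℂ) (F : MvPolynomial ℕ ℂ) :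
    (rapUni ℂ 1 (hypSubst q 1 F)).eval x =
      eval₂Hom ((toRF ℂ).comp MvPolynomial.C)
        (fun k => if k = 1 then x else if k = 2 then genC ℂ q * x else genZ ℂ k) F := by
  have : (Polynomial.evalRingHom x).comp ((rapUni ℂ 1).comp (hypSubst q 1)) = eval₂Hom ((toRF ℂ).comp MvPolynomial.C)
      (fun k => if k = 1 then x else if k = 2 then genC ℂ q * x else genZ ℂ k) := by
    refine ringHom_ext (fun a => ?_) (fun k => ?_)
    · rw [RingHom.comp_apply, RingHom.comp_apply, hypSubst_C, rapUni_C, Polynomial.coe_evalRingHom,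
        Polynomial.eval_C, eval₂Hom_C]; rfl
    · rw [RingHom.comp_apply, RingHom.comp_apply, rapUni_hypSubst_X, Polynomial.coe_evalRingHom, eval₂Hom_X']
      split_ifs <;> simp
  exact RingHom.congr_fun this F

/-- **`Θ₂ F` vanishes at `q z_j`** when `F|_{X_1 = q X_j, X_2 = q X_1} = 0`. [folklore] -/
theorem eval_rapUni_hypSubst_genC_mul (q : ℂ) {j : ℕ} (F : MvPolynomial ℕ ℂ)
    (h0 : substHom 1 (MvPolynomial.C q * MvPolynomial.X j) (hypSubst q 1 F) = 0) :
    (rapUni ℂ 1 (hypSubst q 1 F)).eval (genC ℂ q * genZ ℂ j) = 0 := by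
  have key : (Polynomial.evalRingHom (genC ℂ q * genZ ℂ j)).comp ((rapUni ℂ 1).comp (hypSubst q 1)) =
      (toRF ℂ).comp ((substHom 1 (MvPolynomial.C q * MvPolynomial.X j)).toRingHom.comp (hypSubst q 1)) := by
    refine ringHom_ext (fun a => ?_) (fun k => ?_)
    · simp only [RingHom.comp_apply, hypSubst_C, rapUni_C, Polynomial.coe_evalRingHom, Polynomial.eval_C,
        AlgHom.toRingHom_eq_coe, RingHom.coe_coe, substHom_C]; rfl
    · simp only [RingHom.comp_apply, Polynomial.coe_evalRingHom, AlgHom.toRingHom_eq_coe, RingHom.coe_coe]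
      rw [rapUni_hypSubst_X]
      by_cases hk1 : k = 1
      · subst hk1
        rw [if_pos rfl, Polynomial.eval_X, hypSubst_X_of_ne q (by omega), substHom_X_self, map_mul]; rfl
      rw [if_neg hk1]
      by_cases hk2 : k = 2
      · subst hk2
        rw [if_pos rfl, Polynomial.eval_mul, Polynomial.eval_C, Polynomial.eval_X, show (2 : ℕ) = 1 + 1 from rfl,
          hypSubst_X_self, map_mul, substHom_C, substHom_X_self, map_mul, map_mul, ← mul_assoc]
        simp only [mul_assoc]; rfl
      · rw [if_neg hk2, Polynomial.eval_C, hypSubst_X_of_ne q (show k ≠ 1 + 1 by omega),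
          substHom_X_of_ne _ hk1]; rfl
  have := RingHom.congr_fun key F
  simp only [RingHom.comp_apply, Polynomial.coe_evalRingHom, AlgHom.toRingHom_eq_coe, RingHom.coe_coe] at this
  rw [this, h0, map_zero]

/-- **Reciprocity of `Θ₂ G` in `z_j`** (`j ≥ 3`): if `ι_j (toRF G) = z_j^c toRF G` then
`(Θ₂ G).map ι_j = C(z_j^e) · Θ₂ G` for an integer `e`. [folklore] -/
theorem map_genInv_rapUni_hypSubst {q : ℂ} {G : MvPolynomial ℕ ℂ} {j : ℕ} (hj : 3 ≤ j) {c : ℤ}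
    (hrec : genInv ℂ j (toRF ℂ G) = genZ ℂ j ^ c * toRF ℂ G) :
    ∃ e : ℤ, (rapUni ℂ 1 (hypSubst q 1 G)).map (genInv ℂ j) =
      Polynomial.C (genZ ℂ j ^ e) * rapUni ℂ 1 (hypSubst q 1 G) := by
  set N := G.degreeOf j + c.natAbs with hN
  set d := (G.degreeOf j + c.natAbs + c).toNat with hd
  have hz : genZ ℂ j ≠ 0 := genZ_ne_zero j
  have hpoly := revPoly_eq_X_pow_mul (K₀ := ℂ) hrec
  -- the pair of homomorphisms
  set h : MvPolynomial ℕ ℂ →+* Polynomial (RapidityField ℂ) := (rapUni ℂ 1).comp (hypSubst q 1) with hh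
  set h' : MvPolynomial ℕ ℂ →+* Polynomial (RapidityField ℂ) := (Polynomial.mapRingHom (genInv ℂ j)).comp h with hh'
  have hC' : ∀ a, h (MvPolynomial.C a) = Polynomial.C (genC ℂ a) := fun a => by
    rw [hh, RingHom.comp_apply, hypSubst_C, rapUni_C]
  have hX' : ∀ i, h (MvPolynomial.X i) = if i = 1 then Polynomial.X else if i = 2 then
      Polynomial.C (genC ℂ q) * Polynomial.X else Polynomial.C (genZ ℂ i) := fun i => by
    rw [hh, RingHom.comp_apply, rapUni_hypSubst_X]
  have h'ap : ∀ F, h' F = (h F).map (genInv ℂ j) := fun F => by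
    rw [hh', RingHom.comp_apply, Polynomial.coe_mapRingHom]
  have hXj : h (MvPolynomial.X j) = Polynomial.C (genZ ℂ j) := by
    rw [hX', if_neg (by omega), if_neg (by omega)]
  have hrev := hom_revPoly_eq h h' j N (fun a => by rw [h'ap, hC', Polynomial.map_C, genInv_genC])
    (fun i hij => by
      rw [h'ap, hX']
      split_ifs with h1 h2
      · rw [Polynomial.map_X]
      · rw [Polynomial.map_mul, Polynomial.map_C, Polynomial.map_X, genInv_genC]
      · rw [Polynomial.map_C, genInv_genZ, Function.update_of_ne hij])
    (by rw [h'ap, hXj, Polynomial.map_C, genInv_genZ, Function.update_self, ← Polynomial.C_mul,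
          inv_mul_cancel₀ hz, Polynomial.C_1])
    G (by omega)
  -- compare with the polynomial reciprocity
  rw [hpoly, map_mul, map_pow, hXj, ← hd] at hrev
  -- hrev : C z_j ^ d * h G = C z_j ^ N * h' G
  refine ⟨(d : ℤ) - N, ?_⟩
  have hh'G : h' G = (rapUni ℂ 1 (hypSubst q 1 G)).map (genInv ℂ j) := by
    rw [hh', RingHom.comp_apply, Polynomial.coe_mapRingHom, hh, RingHom.comp_apply]
  have hhG : h G = rapUni ℂ 1 (hypSubst q 1 G) := by rw [hh, RingHom.comp_apply]
  rw [← hh'G, ← hhG]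
  have hCz : (Polynomial.C (genZ ℂ j) : Polynomial (RapidityField ℂ)) ≠ 0 := Polynomial.C_ne_zero.2 hz
  have hsplit : (Polynomial.C (genZ ℂ j) : Polynomial (RapidityField ℂ)) ^ d =
      Polynomial.C (genZ ℂ j) ^ N * Polynomial.C (genZ ℂ j ^ ((d : ℤ) - N)) := by
    rw [← Polynomial.C_pow, ← Polynomial.C_pow, ← Polynomial.C_mul]
    congr 1
    rw [← zpow_natCast, ← zpow_natCast, ← zpow_add₀ hz]
    congr 1; ring
  have : Polynomial.C (genZ ℂ j) ^ N * h' G =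
      Polynomial.C (genZ ℂ j) ^ N * (Polynomial.C (genZ ℂ j ^ ((d : ℤ) - N)) * h G) := by
    rw [← hrev, hsplit, mul_assoc]
  exact mul_left_cancel₀ (pow_ne_zero N hCz) this

/-- **The reflected wheel roots**: for `3 ≤ j ≤ L`, if `Θ₂ F` vanishes at `q z_j` and `toRF F` is
`ι_j`-covariant, then `Θ₂ F` vanishes at `q / z_j` as well. [cite: IkhlefPonsaing2012, (25)–(27)] -/
theorem eval_rapUni_hypSubst_genC_div {q : ℂ} {G : MvPolynomial ℕ ℂ} {j : ℕ} (hj : 3 ≤ j) {c : ℤ}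
    (hrec : genInv ℂ j (toRF ℂ G) = genZ ℂ j ^ c * toRF ℂ G)
    (hroot : (rapUni ℂ 1 (hypSubst q 1 G)).eval (genC ℂ q * genZ ℂ j) = 0) :
    (rapUni ℂ 1 (hypSubst q 1 G)).eval (genC ℂ q * (genZ ℂ j)⁻¹) = 0 := by
  obtain ⟨e, he⟩ := map_genInv_rapUni_hypSubst (q := q) hj hrec
  have hz : genZ ℂ j ≠ 0 := genZ_ne_zero j
  have h1 : genInv ℂ j (genC ℂ q * genZ ℂ j) = genC ℂ q * (genZ ℂ j)⁻¹ := by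
    rw [map_mul, genInv_genC, genInv_genZ, Function.update_self]
  have h2 := Polynomial.eval_map_apply (p := rapUni ℂ 1 (hypSubst q 1 G)) (genInv ℂ j) (genC ℂ q * genZ ℂ j)
  rw [hroot, map_zero, h1, he, Polynomial.eval_mul, Polynomial.eval_C] at h2
  exact (mul_eq_zero.1 h2).resolve_left (zpow_ne_zero e hz)

/-- **All the wheel roots of `η_1(Z)` in `z_1`, for the exact ground state**: `Θ₂ Z` vanishes at
`q z_j` and at `q / z_j`, `3 ≤ j ≤ L`. [cite: IkhlefPonsaing2012, (25)–(27), Prop. 3.4 (proof)] -/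
theorem sum_wheel_roots {q : ℂ} (hq : q ^ 2 + q + 1 = 0) {P : ColPattern (n + 1) → MvPolynomial ℕ ℂ} {a' : ℤ}
    (hP : ∀ Q', ∑ Q, ipTransferMatrixW (n + 1) (genC ℂ q) (genW ℂ) (genZ ℂ) Q Q' * toRF ℂ (P Q) = toRF ℂ (P Q'))
    (hbot : ∀ Q, genInv ℂ 1 (toRF ℂ (P Q)) = genZ ℂ 1 ^ (2 * a') * toRF ℂ (P Q))
    (hsym : ∀ a b : ℕ, 1 ≤ a → a ≤ b → b ≤ 2 * (n + 1) + 1 → rename (Equiv.swap a b) (∑ Q, P Q) = ∑ Q, P Q)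
    {j : ℕ} (hj : 3 ≤ j) (hjL : j ≤ 2 * (n + 1) + 1) :
    (rapUni ℂ 1 (hypSubst q 1 (∑ Q, P Q))).eval (genC ℂ q * genZ ℂ j) = 0 ∧
      (rapUni ℂ 1 (hypSubst q 1 (∑ Q, P Q))).eval (genC ℂ q * (genZ ℂ j)⁻¹) = 0 := by
  have hdirect : (rapUni ℂ 1 (hypSubst q 1 (∑ Q, P Q))).eval (genC ℂ q * genZ ℂ j) = 0 :=
    eval_rapUni_hypSubst_genC_mul q _ (substHom_one_hypSubst_sum_eq_zero hq hP hj (hsym 3 j (by omega) hj hjL))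
  exact ⟨hdirect, eval_rapUni_hypSubst_genC_div hj (sum_genInv_covariant hbot hsym (by omega) hjL) hdirect⟩

end ReflectedRoots

end Literature.Probability.Percolation
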